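import Mathlib
import Summits.NavierStokesRegularity.NavierStokesRegularity.Theorems.TaoLadderRungTwoFlatFlowSymmetriesOn
import HarnessLib

/-!
# SHELL-SHIFT COVARIANCE OF EXACT GRADED FLOWS: `(i, k, t) ↦ S_{i,k+1}(λt)`, `λ = (1+ε₀)^{−5/2}`, is again an exact flow (Tao's discrete
  scale invariance of the cascade, at the level of the shift-set flows `PseudoFlowOnShift`)
  (helper for the K_A♭ parent item stmt-NavierStokesRegularity-22987 `FlatGapCertificatesV2`, child 2A `GradedAdiabaticWakeA` of route
  TaoLadderRungTwoFlat; cell harvest/h2-tao-ladder, p1 g25; LADDER §47.5 L2 (existence, K4: continuation of a hop flow past its landing))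

With `FlowSymmetry.pseudoFlowOnShift_scale` (amplitude `κ`, time `κ`) and `pseudoFlowOnShift_translate` (time origin) this is the third
symmetry needed to read the CONTINUATION of a hop flow past its section time `τ₁` as a flow from the re-centred state
`recentre S τ₁ a = S(1+·, τ₁)/a`: `S_{i,1+k}(τ₁ + t) = a·Y_{i,k}(a(1+ε₀)^{5/2}t)` with `Y` an exact flow from the re-centred state (K4: existence on
the whole clock window from existence up to the section time, hop after hop).

* `quadTermOn_shellShift` — `Q(S(·+1, λ·))_{i,n}(t) = λ·Q(S)_{i,n+1}(λt)` for `λ = (1+ε₀)^{−5/2}`;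
* `pseudoFlowOnShift_shellShift` — the shifted, time-dilated family of an exact zero-slack flow on `[0, τ]` is an exact zero-slack flow on
  `[0, τ/λ]` from the shifted start state.

HONEST FRAMING: an algebraic/calculus identity about MODEL-lattice flows (any table, any shift set); nothing certified; no item closed; nothing
about the Navier–Stokes equations.
-/

noncomputable section

-- the sub-problem namespace repeats the summit name by design (D-0017)
set_option linter.dupNamespace false

namespace Summit.NavierStokesRegularity.NavierStokesRegularity.Theorems.HopTube

open Set Finset Literature.Analysis.FluidPDE Literature.Analysis.FluidPDE.TaoCascade FlowSymmetry

variable {m : ℕ}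

/-- **The nonlinearity of the shell-shifted, time-dilated family**: with `λ = (1+ε₀)^{−5/2}` (`1+ε₀ > 0`),
`quadTermOn 𝕊 ε₀ α (fun j k u => S j (k+1) (λu)) i n t = λ · quadTermOn 𝕊 ε₀ α S i (n+1) (λt)`.
[cite: Tao2016AveragedNS, §4 (4.8) (the clocks `(1+ε₀)^{5n/2}`: discrete scale invariance)] -/
theorem quadTermOn_shellShift (𝕊 : Finset (ℤ × ℤ × ℤ)) {ε₀ : ℝ} (hε : 0 < 1 + ε₀)
    (α : Fin m → Fin m → Fin m → ℤ × ℤ × ℤ → ℝ) (S : Fin m → ℤ → ℝ → ℝ) (i : Fin m) (n : ℤ) (t : ℝ) :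
    quadTermOn 𝕊 ε₀ α (fun j k u => S j (k + 1) ((1 + ε₀) ^ (-(5 : ℝ) / 2) * u)) i n t
      = (1 + ε₀) ^ (-(5 : ℝ) / 2) * quadTermOn 𝕊 ε₀ α S i (n + 1) ((1 + ε₀) ^ (-(5 : ℝ) / 2) * t) := by
  simp only [quadTermOn, Finset.mul_sum]
  refine Finset.sum_congr rfl fun i₁ _ => Finset.sum_congr rfl fun i₂ _ => Finset.sum_congr rfl fun μ _ => ?_
  have e1 : n - μ.2.2 + μ.1 + 1 = n + 1 - μ.2.2 + μ.1 := by ring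
  have e2 : n - μ.2.2 + μ.2.1 + 1 = n + 1 - μ.2.2 + μ.2.1 := by ring
  rw [e1, e2]
  have hpow : (1 + ε₀) ^ ((5 : ℝ) * ((n : ℝ) - μ.2.2) / 2)
      = (1 + ε₀) ^ (-(5 : ℝ) / 2) * (1 + ε₀) ^ ((5 : ℝ) * ((((n + 1 : ℤ)) : ℝ) - μ.2.2) / 2) := by
    rw [← Real.rpow_add hε]
    congr 1
    push_cast
    ring
  rw [hpow]
  ring

/-- **SHELL-SHIFT COVARIANCE OF EXACT FLOWS.** If `(S, F)` is an exact zero-slack `𝕊`-flow at ratio `1+ε₀` (`0 ≤ ε₀`) on `[0, τ]` (`τ > 0`) from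
`S₀`, then `(i, k, t) ↦ S_{i,k+1}(λt)`, `λ = (1+ε₀)^{−5/2}`, with energies `½(·)²`, is an exact zero-slack flow on `[0, τ/λ]` from
`(i, k) ↦ S₀_{i,k+1}`. [cite: Tao2016AveragedNS, §4 Lemma 4.1 (4.5), (4.8)–(4.10), §6.4 (the rescaled system: discrete scale invariance); cell harvest/h2-tao-ladder, K4] -/
theorem pseudoFlowOnShift_shellShift {𝕊 : Finset (ℤ × ℤ × ℤ)} {τ ε₀ : ℝ} (hε₀ : 0 ≤ ε₀) (hτ : 0 < τ)
    {α : Fin m → Fin m → Fin m → ℤ × ℤ × ℤ → ℝ} {S₀ : Fin m → ℤ → ℝ} {S F : Fin m → ℤ → ℝ → ℝ}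
    (h : PseudoFlowOnShift 𝕊 τ ε₀ α 0 0 S₀ (fun i k => (1 / 2) * S₀ i k ^ 2) (fun _ _ => 0) S F) :
    PseudoFlowOnShift 𝕊 (τ / (1 + ε₀) ^ (-(5 : ℝ) / 2)) ε₀ α 0 0 (fun i k => S₀ i (k + 1))
      (fun i k => (1 / 2) * S₀ i (k + 1) ^ 2) (fun _ _ => 0)
      (fun i k t => S i (k + 1) ((1 + ε₀) ^ (-(5 : ℝ) / 2) * t))
      (fun i k t => (1 / 2) * S i (k + 1) ((1 + ε₀) ^ (-(5 : ℝ) / 2) * t) ^ 2) := by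
  have hε : 0 < 1 + ε₀ := by linarith
  set lam : ℝ := (1 + ε₀) ^ (-(5 : ℝ) / 2) with hlam
  have hlam0 : 0 < lam := Real.rpow_pos_of_pos hε _
  have hlamc : lam * (1 + ε₀) ^ ((5 : ℝ) / 2) = 1 := by
    rw [hlam, ← Real.rpow_add hε]; norm_num
  have hcd : ∀ i k, ContDiffOn ℝ 1 (fun t => S i (k + 1) (lam * t)) (Icc 0 (τ / lam)) := fun i k => by
    have := contDiffOn_const_mul_comp_mul 1 hlam0 (h.contDiffOn_S i (k + 1))
    simpa using this
  have hder : ∀ i k u, u ∈ Icc 0 (τ / lam) →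
      derivWithin (fun t => S i (k + 1) (lam * t)) (Icc 0 (τ / lam)) u
        = quadTermOn 𝕊 ε₀ α (fun j k' t => S j (k' + 1) (lam * t)) i k u := by
    intro i k u hu
    have h1 := derivWithin_const_mul_comp_mul (c := 1) hlam0 hτ (h.contDiffOn_S i (k + 1)) hu
    simp only [one_mul] at h1
    rw [h1, motion_eq h i (k + 1) (mul_mem_Icc hlam0 hu), hlam, quadTermOn_shellShift 𝕊 hε α S i k u]
  have hw : ∀ k : ℤ, (0 : ℝ) ≤ 1 + (1 + ε₀) ^ ((10 : ℝ) * k) := fun k => by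
    have := Real.rpow_nonneg hε.le ((10 : ℝ) * k); linarith
  obtain ⟨M, hM⟩ := h.apriori_S
  have hbound : ∀ u, u ∈ Icc 0 (τ / lam) → ∀ (i : Fin m) (k : ℤ),
      (1 + (1 + ε₀) ^ ((10 : ℝ) * k)) * |S i (k + 1) (lam * u)| ≤ M := by
    intro u hu i k
    have hb := hM (lam * u) (mul_mem_Icc hlam0 hu) i (k + 1)
    have hmono : (1 + ε₀) ^ ((10 : ℝ) * k) ≤ (1 + ε₀) ^ ((10 : ℝ) * ((k + 1 : ℤ) : ℝ)) :=
      Real.rpow_le_rpow_of_exponent_le (by linarith) (by push_cast; linarith)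
    exact (mul_le_mul_of_nonneg_right (by linarith) (abs_nonneg _)).trans hb
  refine
    { contDiffOn_S := hcd
      contDiffOn_F := fun i k => contDiffOn_const.mul ((hcd i k).pow 2)
      nonneg_F := fun i k s _ => by positivity
      apriori_S := ⟨M, hbound⟩
      apriori_F := ⟨M, fun u hu i k => ?_⟩
      init_S := fun i k => by simp [h.init_S i (k + 1)]
      init_F := fun i k => by simp [h.init_S i (k + 1)]
      motion := fun i k u hu => by rw [hder i k u hu, sub_self, abs_zero, zero_mul, zero_mul]
      energy := fun i k u hu => ?_
      defect_lower := fun i k s hs => le_rfl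
      defect_upper := fun i k s hs => by simp }
  · -- (4.5) energies: `√(½x²) ≤ |x|`
    have hx : Real.sqrt ((1 / 2) * S i (k + 1) (lam * u) ^ 2) ≤ |S i (k + 1) (lam * u)| := by
      rw [show |S i (k + 1) (lam * u)| = Real.sqrt (S i (k + 1) (lam * u) ^ 2) from (Real.sqrt_sq_eq_abs _).symm]
      exact Real.sqrt_le_sqrt (by nlinarith [sq_nonneg (S i (k + 1) (lam * u))])
    exact (mul_le_mul_of_nonneg_left hx (hw k)).trans (hbound u hu i k)
  · -- (4.9) with equality
    have hd : HasDerivWithinAt (fun t => S i (k + 1) (lam * t))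
        (derivWithin (fun t => S i (k + 1) (lam * t)) (Icc 0 (τ / lam)) u) (Icc 0 (τ / lam)) u :=
      ((hcd i k).differentiableOn_one u hu).hasDerivWithinAt
    have h2 : HasDerivWithinAt (fun t => (1 / 2 : ℝ) * S i (k + 1) (lam * t) ^ 2)
        ((1 / 2 : ℝ) * (((2 : ℕ) : ℝ) * S i (k + 1) (lam * u) ^ (2 - 1) *
          derivWithin (fun t => S i (k + 1) (lam * t)) (Icc 0 (τ / lam)) u)) (Icc 0 (τ / lam)) u :=
      (hd.pow 2).const_mul (1 / 2 : ℝ)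
    show derivWithin (fun t => (1 / 2 : ℝ) * S i (k + 1) (lam * t) ^ 2) (Icc 0 (τ / lam)) u ≤
      quadTermOn 𝕊 ε₀ α (fun j k' t => S j (k' + 1) (lam * t)) i k u * S i (k + 1) (lam * u)
    rw [h2.derivWithin (uniqueDiffOn_Icc (div_pos hτ hlam0) u hu), hder i k u hu]
    norm_num
    apply le_of_eq
    ring

end Summit.NavierStokesRegularity.NavierStokesRegularity.Theorems.HopTube

end
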